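import Summits.QuantumFields.QCD.Theses.PauliWegnerSea
import Summits.QuantumFields.QCD.Theorems.MobilityGap.Negative.LowerPin
import Literature.MathematicalPhysics.QuantumFieldTheory.QCDHeavyQuarkPropagator
import Literature.MathematicalPhysics.QuantumFieldTheory.QCDPhaseQuenchedPositivity

/-!
# `ChiralOneScaleTrajectory` (crux stmt-QuantumFields-17512) — negative-side support: clause (iii) forces
# `limsup_k m_f(k) ≤ 0` flavour by flavour, hence `limsup_k m_crit(k) ≤ 0`

Standing disprover (cdisprove cycle 1).  Sharpening of the landed window lemma of
`Theorems/MobilityGap/Negative/LowerPin.lean` (`eventually_mcrit_lt_of_lower`: `m_crit(k) < 1/10`), in the same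
vocabulary (`fm`, `bare`, `Lower`, `no_rate_sandwich`); the clause (iii) LOWER of the crux is byte-identical to the
one of `MobilityGap` / `OneScaleTrajectory` / `ChiralMobilityGap`, so the lemma serves all four items.

* `norm_inv_diracMatrix_apply_le_single` — the tree's heavy-quark propagator bound
  (`norm_inv_diracMatrix_apply_le_of_le`, hopping regime) asked of ONE flavour only: if `m_f ≥ m₀ > 0` then every
  same-flavour entry of `(diracMatrix U mq)⁻¹` obeys `≤ m₀⁻¹ (4/(m₀+4))^{d_i}` whatever the other masses are
  (either every flavour block is invertible and the block formula applies, or the whole matrix is singular and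
  `Matrix.inv` is the junk `0`).
* `fm_axis_le_of_heavy_flavour` — hence for EVERY exponent `0 ≤ s`, every coupling, torus, and `n ≤ S`:
  `fm(n e₀, s) ≤ (144/m₀)^s e^{-s log((m₀+4)/4) n}` for that flavour (lattice-rate decay).
* `eventually_bare_lt_of_lower` — clause (iii) (at its own exponent `s`) therefore forces, for every flavour and
  every `m₀ > 0`, `m_f(k) < m₀` EVENTUALLY: `limsup_k m_f(k) ≤ 0` (`no_rate_sandwich` with the lattice rate
  `s log((m₀+4)/4)` against the physical rate `C₁ a_k → 0`).
* `eventually_mcrit_lt_of_lower_pos` — so `m_crit(k) < m₀` eventually for every `m₀ > 0`: the critical line that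
  ANY witness tunes to is approached from the massless/supercritical side, `limsup m_crit ≤ 0`; with clause (i)
  (`m_f(k) > −1` eventually) the realised bare masses of a witness accumulate in `[−1, 0]`.  For the chiral crux:
  the pin asks the honest gap to close as `m → 0⁺` along `m_crit(k)`, and (iii) independently forbids parking
  `m_crit` at any positive lattice mass; clause (iv) is contentful exactly on the sliver `m_f(k) ∈ (m_crit(k), 0⁺]`
  where Seiler positivity (`det D_W > 0` for positive bare mass) is unavailable.
-/

noncomputable section

namespace Summit.QuantumFields.QCD.Theorems.ChiralOneScaleTrajectory.Negative

open scoped BigOperators Topology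
open MeasureTheory Filter Set
open Literature.MathematicalPhysics.QuantumFieldTheory Literature.MathematicalPhysics.QuantumLattice
  Literature.Probability.LatticeModels
open Summit.QuantumFields.QCD.Theorems.MobilityGapNegative

variable {Nf : ℕ}

/-- **Single-flavour heavy-quark propagator bound.** If the bare mass of flavour `f` is `≥ m₀ > 0`, every
same-flavour entry of the inverse Dirac matrix is `≤ m₀⁻¹ (4/(m₀+4))^{d_i(p,q)}` for each coordinate `i`, for
every field and torus, whatever the other flavours' masses. -/
theorem norm_inv_diracMatrix_apply_le_single {S : ℕ} [NeZero S] (U : GaugeConfig 4 S SU3) (mq : Fin Nf → ℝ)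
    {m₀ : ℝ} (hm₀ : 0 < m₀) (f : Fin Nf) (hM : m₀ ≤ mq f) (p q : TorusSite 4 S × Fin 3 × Fin 4) (i : Fin 4) :
    ‖(diracMatrix U mq)⁻¹ (quarkEquiv (f, p)) (quarkEquiv (f, q))‖ ≤
      m₀⁻¹ * (4 / (m₀ + 4)) ^ (p.1 i - q.1 i).valMinAbs.natAbs := by
  by_cases hA : ∀ g, (wilsonDirac (fundamentalRep (Fin 3)) U (mq g) 1).det ≠ 0
  · rw [inv_diracMatrix_apply_same_flavour U mq hA]
    have hpos : 0 < mq f := hm₀.trans_le hM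
    obtain ⟨-, hb⟩ := norm_inv_wilsonDirac_apply_le (fundamentalRep (Fin 3))
      fundamentalRep_mem_unitaryGroup U hpos p q i
    refine hb.trans ?_
    rw [heavy_prefactor_eq hpos]
    have hθ : 4 / (mq f + 4) ≤ 4 / (m₀ + 4) :=
      div_le_div_of_nonneg_left (by norm_num) (by linarith) (by linarith)
    have hθ0 : 0 ≤ 4 / (mq f + 4) := by positivity
    exact mul_le_mul (inv_anti₀ hm₀ hM) (pow_le_pow_left₀ hθ0 hθ _) (pow_nonneg hθ0 _)
      (inv_nonneg.2 hm₀.le)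
  · -- some flavour block is singular: the whole matrix is singular and `Matrix.inv` is the junk `0`
    push Not at hA
    obtain ⟨g, hg⟩ := hA
    have hdet : (diracMatrix U mq).det = 0 := by
      rw [det_diracMatrix]
      exact Finset.prod_eq_zero (Finset.mem_univ g) hg
    rw [Matrix.inv_def, hdet, Ring.inverse_zero, zero_smul, Matrix.zero_apply, norm_zero]
    positivity

/-- **Lattice-rate decay of the phase-quenched fractional moment along the time axis for ONE heavy flavour**, at
EVERY exponent `s ≥ 0`: `fm(n e₀, s) ≤ (144/m₀)^s e^{-s log((m₀+4)/4) n}` (`n ≤ S`, torus of side `2S+1`). -/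
theorem fm_axis_le_of_heavy_flavour (β : ℝ) (mq : Fin Nf → ℝ) {m₀ : ℝ} (hm₀ : 0 < m₀) (f : Fin Nf)
    (hM : m₀ ≤ mq f) {s : ℝ} (hs : 0 ≤ s) (S n : ℕ) (hn : n ≤ S) :
    fm Nf β mq S f (Pi.single 0 (n : ℤ)) s ≤
      (144 / m₀) ^ s * Real.exp (-(Real.log ((m₀ + 4) / 4) * s * n)) := by
  set θ₀ : ℝ := 4 / (m₀ + 4) with hθ₀
  have hθ₀pos : 0 < θ₀ := by positivity
  have hlog : Real.log ((m₀ + 4) / 4) = -Real.log θ₀ := by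
    rw [← Real.log_inv, hθ₀, inv_div]
  set v : Site 4 := Pi.single 0 (n : ℤ) with hv
  have hvi : |v 0| ≤ (S : ℤ) := by
    rw [hv, Pi.single_eq_same, abs_of_nonneg (by positivity)]
    exact_mod_cast hn
  have hcd : ((Torus.proj (2 * S + 1) (0 : Site 4)) 0 - (Torus.proj (2 * S + 1) v) 0).valMinAbs.natAbs = n := by
    simp only [Torus.proj, Pi.zero_apply, Int.cast_zero, zero_sub]
    have h := natAbs_valMinAbs_neg_intCast (v 0) (by exact_mod_cast hvi)
    rw [h, hv, Pi.single_eq_same, Int.natAbs_natCast]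
  set K : ℝ := m₀⁻¹ * θ₀ ^ n with hK
  have hK0 : 0 ≤ K := by positivity
  have hentry : ∀ (U : GaugeConfig 4 (2 * S + 1) SU3) (a' : Fin 3) (i : Fin 4) (b : Fin 3) (j : Fin 4),
      ‖(diracMatrix U mq)⁻¹ (quarkEquiv (f, (Torus.proj (2 * S + 1) 0, a', i)))
        (quarkEquiv (f, (Torus.proj (2 * S + 1) v, b, j)))‖ ≤ K := by
    intro U a' i b j
    have h := norm_inv_diracMatrix_apply_le_single U mq hm₀ f hM (Torus.proj (2 * S + 1) 0, a', i)
      (Torus.proj (2 * S + 1) v, b, j) 0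
    rwa [hcd] at h
  have hsum : ∀ U : GaugeConfig 4 (2 * S + 1) SU3,
      (∑ a' : Fin 3, ∑ i : Fin 4, ∑ b : Fin 3, ∑ j : Fin 4,
        ‖(diracMatrix U mq)⁻¹ (quarkEquiv (f, (Torus.proj (2 * S + 1) 0, a', i)))
          (quarkEquiv (f, (Torus.proj (2 * S + 1) v, b, j)))‖) ≤ 144 * K := by
    intro U
    calc _ ≤ ∑ _a' : Fin 3, ∑ _i : Fin 4, ∑ _b : Fin 3, ∑ _j : Fin 4, K :=
          Finset.sum_le_sum fun a' _ => Finset.sum_le_sum fun i _ => Finset.sum_le_sum fun b _ =>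
            Finset.sum_le_sum fun j _ => hentry U a' i b j
      _ = 144 * K := by simp; ring
  set B₀ : ℝ := (144 / m₀) ^ s * Real.exp (-(Real.log ((m₀ + 4) / 4) * s * n)) with hB₀
  have hB : (144 * K) ^ s ≤ B₀ := by
    have h1 : (144 * K) = (144 / m₀) * θ₀ ^ n := by rw [hK, div_eq_mul_inv]; ring
    rw [h1, Real.mul_rpow (by positivity) (by positivity), hB₀, hlog]
    refine mul_le_mul_of_nonneg_left (le_of_eq ?_) (Real.rpow_nonneg (by positivity) _)
    rw [← Real.rpow_natCast, ← Real.rpow_mul hθ₀pos.le, Real.rpow_def_of_pos hθ₀pos]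
    congr 1; ring
  have hX : ∀ U : GaugeConfig 4 (2 * S + 1) SU3,
      (∑ a' : Fin 3, ∑ i : Fin 4, ∑ b : Fin 3, ∑ j : Fin 4,
        ‖(diracMatrix U mq)⁻¹ (quarkEquiv (f, (Torus.proj (2 * S + 1) 0, a', i)))
          (quarkEquiv (f, (Torus.proj (2 * S + 1) v, b, j)))‖) ^ s ≤ B₀ := fun U =>
    (Real.rpow_le_rpow (by positivity) (hsum U) hs).trans hB
  have hZ := integral_norm_det_diracMatrix_pos_all (S := 2 * S + 1) β mq
  have hnum : (∫ U : GaugeConfig 4 (2 * S + 1) SU3, ‖(diracMatrix U mq).det‖ *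
      (∑ a' : Fin 3, ∑ i : Fin 4, ∑ b : Fin 3, ∑ j : Fin 4,
        ‖(diracMatrix U mq)⁻¹ (quarkEquiv (f, (Torus.proj (2 * S + 1) 0, a', i)))
          (quarkEquiv (f, (Torus.proj (2 * S + 1) v, b, j)))‖) ^ s
      ∂(wilsonMeasure (fundamentalRep (Fin 3)) β)) ≤
      (∫ U : GaugeConfig 4 (2 * S + 1) SU3, ‖(diracMatrix U mq).det‖
        ∂(wilsonMeasure (fundamentalRep (Fin 3)) β)) * B₀ := by
    rw [← integral_mul_const]
    refine integral_mono_of_nonneg (Eventually.of_forall fun U => ?_)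
      ((integrable_norm_det_diracMatrix mq _).mul_const B₀) (Eventually.of_forall fun U => ?_)
    · exact mul_nonneg (norm_nonneg _) (Real.rpow_nonneg (by positivity) _)
    · exact mul_le_mul_of_nonneg_left (hX U) (norm_nonneg _)
  unfold fm
  rw [div_le_iff₀ hZ]
  exact hnum.trans_eq (mul_comm _ _)

/-- **Clause (iii) forces `limsup_k m_f(k) ≤ 0` for every flavour.**  Along any regularisation and mass tuple for
which the LOWER clause holds, for every flavour `f` and every `m₀ > 0` the realised bare mass satisfies
`m_f(k) < m₀` eventually: otherwise, at the infinitely many lattice-heavy `k`, `fm_axis_le_of_heavy_flavour` bounds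
the moment by `C e^{-s log((m₀+4)/4) n}` on every torus `S = n ≥ L_k`, while (iii) demands
`≥ c₀ e^{-C₁ a_k n}(n+1)^{-p}` with `C₁ a_k → 0` — `no_rate_sandwich`. -/
theorem eventually_bare_lt_of_lower (reg : QCDRegularisation Nf) (m : Fin Nf → ℝ) (h : Lower reg m)
    (f : Fin Nf) {m₀ : ℝ} (hm₀ : 0 < m₀) :
    ∀ᶠ k in atTop, reg.mcrit k + reg.a k * m f / reg.Zm k < m₀ := by
  by_contra hne
  rw [not_eventually] at hne
  obtain ⟨s, c₀, C₁, p, hs, -, hc₀, hL⟩ := h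
  set μ : ℝ := Real.log ((m₀ + 4) / 4) with hμ
  have hμ0 : 0 < μ := Real.log_pos (by rw [lt_div_iff₀ (by norm_num : (0 : ℝ) < 4)]; linarith)
  have hμs : 0 < μ * s := mul_pos hμ0 hs
  have hsmall : ∀ᶠ k in atTop, C₁ * reg.a k ≤ μ * s / 2 := by
    have ht : Tendsto (fun k => C₁ * reg.a k) atTop (𝓝 (C₁ * 0)) := reg.tendsto_a.const_mul C₁
    rw [mul_zero] at ht
    exact ht.eventually (eventually_le_nhds (by positivity))
  obtain ⟨k, ⟨hLk, hsk⟩, hhk⟩ := ((hL.and hsmall).and_frequently (hne.mono fun k hk => not_lt.1 hk)).exists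
  refine no_rate_sandwich (A := C₁ * reg.a k) (B := μ * s) (C := (144 / m₀) ^ s) (p := p) hc₀ (by linarith)
    (reg.L k) fun n hn => ?_
  have h1 := hLk n hn f n le_rfl
  have h2 := fm_axis_le_of_heavy_flavour (reg.β k) (bare reg m k) hm₀ f hhk hs.le n n le_rfl
  have e : C₁ * reg.a k * (n : ℝ) = C₁ * (reg.a k * n) := mul_assoc _ _ _
  have e' : -(Real.log ((m₀ + 4) / 4) * s * n) = -(μ * s * n) := by rw [hμ]
  rw [e]
  rw [e'] at h2
  exact h1.trans h2

/-- **Hence `limsup_k m_crit(k) ≤ 0` for every witness** (positive tuple, `N_f ≥ 1`): the critical mass of a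
regularisation carrying clause (iii) is eventually below every positive level. -/
theorem eventually_mcrit_lt_of_lower_pos (reg : QCDRegularisation Nf) (m : Fin Nf → ℝ) (hm : ∀ f, 0 < m f)
    (h : Lower reg m) (f : Fin Nf) {m₀ : ℝ} (hm₀ : 0 < m₀) : ∀ᶠ k in atTop, reg.mcrit k < m₀ := by
  filter_upwards [eventually_bare_lt_of_lower reg m h f hm₀] with k hk
  have hpos : 0 < reg.a k * m f / reg.Zm k := div_pos (mul_pos (reg.a_pos k) (hm f)) (reg.Zm_pos k)
  linarith

/-- With clause (i) as well, the realised bare masses of a witness accumulate in `[−1, 0]`: for every `m₀ > 0`,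
eventually `−1 < m_f(k) < m₀`. -/
theorem eventually_bare_mem_of_clauseI_lower (reg : QCDRegularisation Nf) (m : Fin Nf → ℝ) (hI : ClauseI reg m)
    (h : Lower reg m) (f : Fin Nf) {m₀ : ℝ} (hm₀ : 0 < m₀) :
    ∀ᶠ k in atTop, -1 < reg.mcrit k + reg.a k * m f / reg.Zm k ∧ reg.mcrit k + reg.a k * m f / reg.Zm k < m₀ :=
  (hI f).and (eventually_bare_lt_of_lower reg m h f hm₀)

end Summit.QuantumFields.QCD.Theorems.ChiralOneScaleTrajectory.Negative

end
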